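import Summits.RiemannHypothesis.RiemannHypothesis.Theorems.SpectralTraceWindowStepCoagulationLittleO
import HarnessLib

/-!
# Saturated atoms have linear density (line `conjugate-point`, RH-free structure of the edge horn)

Route `RiemannHypothesis/SpectralTrace`, crux `WindowStep` (stmt-RiemannHypothesis-14659), line
`conjugate-point`, in support of the registered stub `stub_coagulationDense` (at a conjugate point `a`
no level-`2a` window family whose multiplicities have positive upper logarithmic density lies in the
real zero set `Z_ℝ(û)` of a ground-state transform). This file records, with no hypothesis on `ε(a)`,
what a VIOLATOR must look like — the lower half of the first-order balance, at non-sharp constants: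

* `saturatedAtoms_linear_density` — for every `a > 0` there is `κ = κ(a) > 0` (uniform over ground
  states and families) such that: if `u` is a ground state of the window `[-a, a]` and `γ : ι → ℝ` a
  real family reproducing the Weil functional on the Weil tests of `[-2a, 2a]` with EVERY atom a real
  zero of `û(1/2 + i·)`, then the SATURATED atoms `x` (`1 < |x|`, `#{i | γ i = x} ≥ κ log |x|`) have
  linear density: `#{x : 1 < |x| ≤ r, κ log|x| ≤ #{i | γ i = x}} ≥ κ r` for all large `r`;
* `coagulation_excluded_or_saturated` — the same as a dichotomy for an arbitrary level-`2a` family: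
  either some `û(1/2 + iγ_i) ≠ 0` (the conclusion of the stub) or the saturated atoms have linear
  density.

With the Jensen count (`exists_card_real_zeros_le_slope`: at most `(2a/log 2) r + β` real zeros in
`[-r, r]`) a violator is thus a set of real zeros of `û` of LINEAR growth, a positive proportion of
which carry logarithmic multiplicities (the "orthogonal crystal").

Proof. Constants of the window `2a` only: the lower local Weyl law `card_near_ge_log_of_windowTrace`
(`R₀, c, C`), the UNIFORM upper law `card_near_le_log_uniform` (`C₁`; so every multiplicity is
`≤ C₁(1 + log(1 + |x|))`), the Jensen slope `α = 2a/log 2`, `L = 2R₀ + 2`, `κ = c/(24 L (α + C₁ + 1))`.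
In the cell `[T − R₀, T + R₀]` (`T ≥ H`, `ℓ = log(1+T) ≥ 1`; `saturatedAtoms_cell`):
`(c/2) ℓ ≤ #s ≤ Σ_{saturated} m(x) + Σ_{unsaturated} m(x) ≤ 3C₁ℓ·#G + 2κℓ·#A`, so
`c/2 ≤ 3C₁ #G + 2κ #A`. Stacking `n` disjoint cells (`saturatedAtoms_stack`) and bounding the atoms
(real zeros of `û` in `[0, H + Ln + R₀]`) by the Jensen count: `n c/2 ≤ 3C₁ #G(r_n) + 2κ(α r_n + β)`,
`r_n = H + Ln + R₀ ≤ r < r_n + L`, whence `#G(r) ≥ κ r` for `r ≥ r₀`.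
-/

set_option linter.dupNamespace false

noncomputable section

open Complex Set Filter MeasureTheory
open scoped Real Topology

namespace Summit.RiemannHypothesis.RiemannHypothesis.Theorems.SpectralTraceWindowStep

open Literature.NumberTheory.LFunctions
open Summit.RiemannHypothesis.RiemannHypothesis.Theorems.WindowTraceArch.Negative

/-- **One cell.** Let `γ : ι → ℝ` have finite fibres, all atoms in a set `Z`, multiplicities
`m(x) = #{i | γ i = x} ≤ C₁(1 + log(1 + |x|))`, and at least `c log(1 + |T|) − C` indices within `R₀`
of every height `T`. Then for `T ≥ H ≥ 2 + R₀ + e^{2C/c}` the atoms `A` of the cell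
`[T − R₀, T + R₀]` and its saturated atoms `G = {x ∈ A : κ log|x| ≤ m(x)}` satisfy
`c/2 ≤ 3C₁ #G + 2κ #A` (mass `≥ (c/2) log(1+T)` split over saturated atoms, each of mass
`≤ 3C₁ log(1+T)`, and unsaturated ones, each of mass `< 2κ log(1+T)`). [folklore] -/
theorem saturatedAtoms_cell {ι : Type} (γ : ι → ℝ) (Z : ℝ → Prop) (hvan : ∀ i, Z (γ i))
    (hfin : ∀ x : ℝ, {i : ι | γ i = x}.Finite) {R₀ c C C₁ κ H : ℝ} (hc : 0 < c) (hC₁ : 0 < C₁)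
    (hκ : 0 < κ) (hR₀ : 0 < R₀) (hH : 2 + R₀ + Real.exp (2 * C / c) ≤ H)
    (hlow : ∀ T : ℝ, ∃ s : Finset ι, (∀ i ∈ s, |γ i - T| ≤ R₀) ∧
      c * Real.log (1 + |T|) - C ≤ (s.card : ℝ))
    (hmult : ∀ x : ℝ, ({i : ι | γ i = x}.ncard : ℝ) ≤ C₁ * (1 + Real.log (1 + |x|)))
    {T : ℝ} (hT : H ≤ T) :
    ∃ A G : Finset ℝ, G ⊆ A ∧ (∀ x ∈ A, Z x ∧ |x - T| ≤ R₀) ∧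
      (∀ x ∈ G, κ * Real.log |x| ≤ ({i : ι | γ i = x}.ncard : ℝ)) ∧
      c / 2 ≤ 3 * C₁ * G.card + 2 * κ * A.card := by
  classical
  obtain ⟨s, hs, hcard⟩ := hlow T
  have hexp : 0 < Real.exp (2 * C / c) := Real.exp_pos _
  have hT0 : 0 < T := by linarith
  rw [abs_of_pos hT0] at hcard
  set ℓ : ℝ := Real.log (1 + T) with hℓ
  have hℓ1 : 1 ≤ ℓ := by
    have h3 : Real.exp 1 ≤ 1 + T := by
      have := Real.exp_one_lt_d9
      linarith
    have := Real.log_le_log (Real.exp_pos 1) h3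
    rwa [Real.log_exp] at this
  have hℓpos : 0 < ℓ := by linarith
  have hℓC : C ≤ c / 2 * ℓ := by
    have h1 : Real.exp (2 * C / c) ≤ 1 + T := by linarith
    have h2 : 2 * C / c ≤ ℓ := by
      rw [hℓ, ← Real.log_exp (2 * C / c)]
      exact Real.log_le_log hexp h1
    rw [div_le_iff₀ hc] at h2
    linarith
  have hpos : ∀ i ∈ s, 1 < γ i ∧ Real.log |γ i| ≤ 2 * ℓ ∧ 1 + Real.log (1 + |γ i|) ≤ 3 * ℓ := by
    intro i hi
    have hnear : |γ i - T| ≤ R₀ := hs i hi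
    rw [abs_le] at hnear
    have hx1 : 1 < γ i := by linarith [hnear.1]
    have hx0 : 0 < γ i := by linarith
    have hlogx : Real.log (1 + |γ i|) ≤ 2 * ℓ := by
      rw [abs_of_pos hx0]
      have h6 : 1 + γ i ≤ (1 + T) ^ 2 := by nlinarith [hnear.2]
      have h5 : Real.log (1 + γ i) ≤ Real.log ((1 + T) ^ 2) :=
        Real.log_le_log (by linarith) h6
      rw [Real.log_pow, Nat.cast_ofNat] at h5
      linarith
    refine ⟨hx1, ?_, by linarith⟩
    have : Real.log |γ i| ≤ Real.log (1 + |γ i|) :=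
      Real.log_le_log (by rw [abs_of_pos hx0]; exact hx0) (by linarith)
    linarith
  set m : ℝ → ℝ := fun x => ({j : ι | γ j = x}.ncard : ℝ) with hm
  set P : ℝ → Prop := fun x => κ * Real.log |x| ≤ m x with hP
  refine ⟨s.image γ, (s.image γ).filter P, Finset.filter_subset _ _, ?_, ?_, ?_⟩
  · intro x hx
    obtain ⟨i, hi, rfl⟩ := Finset.mem_image.1 hx
    exact ⟨hvan i, hs i hi⟩
  · intro x hx
    exact (Finset.mem_filter.1 hx).2
  · -- `#s ≤ Σ_{atoms} m`
    have h1 : (s.card : ℝ) ≤ ∑ x ∈ s.image γ, m x := by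
      have e : (s.card : ℝ) = ∑ x ∈ s.image γ, ((s.filter (fun i => γ i = x)).card : ℝ) := by
        rw [Finset.card_eq_sum_card_image γ s]
        push_cast
        rfl
      rw [e]
      refine Finset.sum_le_sum fun x _ => ?_
      have hsub' : (↑(s.filter (fun j => γ j = x)) : Set ι) ⊆ {j : ι | γ j = x} :=
        fun j hj => (Finset.mem_filter.1 (Finset.mem_coe.1 hj)).2
      have h := Set.ncard_le_ncard hsub' (hfin x)
      rw [Set.ncard_coe_finset] at h
      simp only [hm]
      exact_mod_cast h
    -- split into saturated and unsaturated atoms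
    have h2 : ∑ x ∈ s.image γ, m x =
        ∑ x ∈ (s.image γ).filter P, m x + ∑ x ∈ (s.image γ).filter (fun x => ¬ P x), m x :=
      (Finset.sum_filter_add_sum_filter_not _ P m).symm
    have hG : ∑ x ∈ (s.image γ).filter P, m x ≤
        (((s.image γ).filter P).card : ℝ) * (3 * C₁ * ℓ) := by
      have : ∑ x ∈ (s.image γ).filter P, m x ≤ ∑ _x ∈ (s.image γ).filter P, 3 * C₁ * ℓ := by
        refine Finset.sum_le_sum fun x hx => ?_
        obtain ⟨hxA, -⟩ := Finset.mem_filter.1 hx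
        obtain ⟨i, hi, rfl⟩ := Finset.mem_image.1 hxA
        obtain ⟨-, -, hlogi⟩ := hpos i hi
        calc m (γ i) ≤ C₁ * (1 + Real.log (1 + |γ i|)) := hmult (γ i)
          _ ≤ C₁ * (3 * ℓ) := mul_le_mul_of_nonneg_left hlogi hC₁.le
          _ = 3 * C₁ * ℓ := by ring
      rwa [Finset.sum_const, nsmul_eq_mul] at this
    have hB : ∑ x ∈ (s.image γ).filter (fun x => ¬ P x), m x ≤
        ((s.image γ).card : ℝ) * (2 * κ * ℓ) := by
      have : ∑ x ∈ (s.image γ).filter (fun x => ¬ P x), m x ≤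
          ∑ _x ∈ (s.image γ).filter (fun x => ¬ P x), 2 * κ * ℓ := by
        refine Finset.sum_le_sum fun x hx => ?_
        obtain ⟨hxA, hnP⟩ := Finset.mem_filter.1 hx
        obtain ⟨i, hi, rfl⟩ := Finset.mem_image.1 hxA
        obtain ⟨-, hlogi, -⟩ := hpos i hi
        have hlt : m (γ i) < κ * Real.log |γ i| := lt_of_not_ge hnP
        have := mul_le_mul_of_nonneg_left hlogi hκ.le
        linarith
      rw [Finset.sum_const, nsmul_eq_mul] at this
      refine this.trans ?_
      have hcardle : (((s.image γ).filter (fun x => ¬ P x)).card : ℝ) ≤ (s.image γ).card := by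
        exact_mod_cast Finset.card_filter_le _ _
      exact mul_le_mul_of_nonneg_right hcardle (by positivity)
    have hmain : c / 2 * ℓ ≤
        ℓ * (3 * C₁ * ((s.image γ).filter P).card + 2 * κ * (s.image γ).card) := by
      linarith
    by_contra hcon
    push Not at hcon
    have := mul_lt_mul_of_pos_left hcon hℓpos
    linarith

/-- **Stacking the cells.** From the one-cell inequality at every height `T ≥ H`, `n`
disjoint cells at the heights `H + L, …, H + Ln` (`L = 2R₀ + 2`) give finite sets `G` (saturated
atoms) and `A ⊆ Z` (atoms) inside `[H − R₀, H + Ln + R₀]` with `n c/2 ≤ 3C₁ #G + 2κ #A`. [folklore] -/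
theorem saturatedAtoms_stack {ι : Type} (γ : ι → ℝ) (Z : ℝ → Prop) {R₀ c C₁ κ H L : ℝ}
    (hR₀ : 0 < R₀) (hL : L = 2 * R₀ + 2)
    (hcell : ∀ T : ℝ, H ≤ T → ∃ A G : Finset ℝ, G ⊆ A ∧ (∀ x ∈ A, Z x ∧ |x - T| ≤ R₀) ∧
      (∀ x ∈ G, κ * Real.log |x| ≤ ({i : ι | γ i = x}.ncard : ℝ)) ∧
      c / 2 ≤ 3 * C₁ * G.card + 2 * κ * A.card) (n : ℕ) :
    ∃ A G : Finset ℝ,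
      (∀ x ∈ A, Z x ∧ H - R₀ ≤ x ∧ x ≤ H + L * n + R₀) ∧
      (∀ x ∈ G, H - R₀ ≤ x ∧ x ≤ H + L * n + R₀ ∧
        κ * Real.log |x| ≤ ({i : ι | γ i = x}.ncard : ℝ)) ∧
      (n : ℝ) * (c / 2) ≤ 3 * C₁ * G.card + 2 * κ * A.card := by
  classical
  have hL0 : 0 < L := by rw [hL]; positivity
  induction n with
  | zero =>
    exact ⟨∅, ∅, fun x hx => absurd hx (Finset.notMem_empty x),
      fun x hx => absurd hx (Finset.notMem_empty x), by simp⟩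
  | succ n ih =>
    obtain ⟨A, G, hA, hG, hcnt⟩ := ih
    have hn0 : (0 : ℝ) ≤ n := Nat.cast_nonneg n
    have hLn : 0 ≤ L * (n + 1) := by positivity
    obtain ⟨A', G', hG'A', hA', hG', hcnt'⟩ := hcell (H + L * (n + 1)) (by linarith)
    have hdisjA : Disjoint A A' := by
      rw [Finset.disjoint_left]
      intro x hx hx'
      have h1 := (hA x hx).2.2
      have h2 := (hA' x hx').2
      rw [abs_le] at h2
      linarith [h2.1]
    have hdisjG : Disjoint G G' := by
      rw [Finset.disjoint_left]
      intro x hx hx'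
      have h1 := (hG x hx).2.1
      have h2 := (hA' x (hG'A' hx')).2
      rw [abs_le] at h2
      linarith [h2.1]
    have hLn' : L * n ≤ L * (n + 1) := by nlinarith
    refine ⟨A ∪ A', G ∪ G', fun x hx => ?_, fun x hx => ?_, ?_⟩
    · rcases Finset.mem_union.1 hx with hx | hx
      · obtain ⟨h0, h1, h2⟩ := hA x hx
        refine ⟨h0, h1, ?_⟩
        push_cast
        linarith
      · obtain ⟨h0, h1⟩ := hA' x hx
        rw [abs_le] at h1
        refine ⟨h0, ?_, ?_⟩
        · linarith [h1.1]
        · push_cast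
          linarith [h1.2]
    · rcases Finset.mem_union.1 hx with hx | hx
      · obtain ⟨h1, h2, h3⟩ := hG x hx
        refine ⟨h1, ?_, h3⟩
        push_cast
        linarith
      · have h1 := (hA' x (hG'A' hx)).2
        rw [abs_le] at h1
        refine ⟨?_, ?_, hG' x hx⟩
        · linarith [h1.1]
        · push_cast
          linarith [h1.2]
    · rw [Finset.card_union_of_disjoint hdisjA, Finset.card_union_of_disjoint hdisjG]
      push_cast
      linarith

/-- **Saturated atoms of a coagulated family have linear density (RH-free).** For every `a > 0`
there is `κ > 0` depending on `a` only such that: if `u` is a ground state of the window `[-a, a]`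
and `γ : ι → ℝ` is a real family reproducing the Weil functional on the Weil tests supported in
`[-2a, 2a]` whose atoms are ALL real zeros of `û(1/2 + i·)`, then for all large `r` the set of
saturated atoms `{x : 1 < |x| ≤ r, κ log|x| ≤ #{i | γ i = x}}` is finite and has at least `κ r`
elements. (Lower local Weyl law + uniform upper law + the linear Jensen count of the real zeros of
`û`.) [folklore] -/
theorem saturatedAtoms_linear_density :
    ∀ a : ℝ, 0 < a → ∃ κ : ℝ, 0 < κ ∧
      ∀ u : ℝ → ℂ, Literature.NumberTheory.LFunctions.IsWeilGroundState a u →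
        ∀ (ι : Type) (γ : ι → ℝ),
          (∀ g : ℝ → ℂ, Literature.NumberTheory.LFunctions.IsWeilTest g →
            tsupport g ⊆ Set.Icc (-(2 * a)) (2 * a) →
              HasSum (fun i => Literature.NumberTheory.LFunctions.weilMellin g (1 / 2 + (γ i : ℂ) * Complex.I))
                (Literature.NumberTheory.LFunctions.weilFunctional g)) →
          (∀ i : ι, Literature.NumberTheory.LFunctions.weilMellin u (1 / 2 + (γ i : ℂ) * Complex.I) = 0) →
          ∃ r₀ : ℝ, ∀ r : ℝ, r₀ ≤ r →
            {x : ℝ | 1 < |x| ∧ |x| ≤ r ∧ κ * Real.log |x| ≤ ({i : ι | γ i = x}.ncard : ℝ)}.Finite ∧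
            κ * r ≤ ({x : ℝ | 1 < |x| ∧ |x| ≤ r ∧
              κ * Real.log |x| ≤ ({i : ι | γ i = x}.ncard : ℝ)}.ncard : ℝ) := by
  intro a ha
  have h2a : (0 : ℝ) < 2 * a := by positivity
  obtain ⟨R₀, c, C, hR₀, hc, hlow⟩ := card_near_ge_log_of_windowTrace h2a
  obtain ⟨C₁, hC₁, hupp⟩ := card_near_le_log_uniform h2a
  have hlog2 : 0 < Real.log 2 := Real.log_pos one_lt_two
  set α : ℝ := 2 * a / Real.log 2 with hα
  have hα0 : 0 < α := by positivity
  set L : ℝ := 2 * R₀ + 2 with hL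
  have hL0 : 0 < L := by positivity
  set κ : ℝ := c / (24 * L * (α + C₁ + 1)) with hκ
  have hκ0 : 0 < κ := by positivity
  have hκdef : κ * (24 * L * (α + C₁ + 1)) = c := by
    rw [hκ]
    field_simp
  have hκL : 0 < κ * L := mul_pos hκ0 hL0
  have hκLα : 0 < κ * L * α := mul_pos hκL hα0
  have hκLC : 0 < κ * L * C₁ := mul_pos hκL hC₁
  have hκα' : 16 * κ * α * L ≤ c := by linarith
  have hκC' : 24 * C₁ * κ * L ≤ c := by linarith
  refine ⟨κ, hκ0, ?_⟩
  intro u hu ι γ hγ hvan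
  obtain ⟨β, hJ⟩ := exists_card_real_zeros_le_slope hu
  set β' : ℝ := max β 0 with hβ'
  have hβ'0 : 0 ≤ β' := le_max_right _ _
  have hββ' : β ≤ β' := le_max_left _ _
  have hfin : ∀ x : ℝ, {i : ι | γ i = x}.Finite := fun x =>
    (finite_abs_le_of_windowTrace h2a hγ |x|).subset fun i hi => by
      simp only [Set.mem_setOf_eq] at hi ⊢
      rw [hi]
  -- every multiplicity is `≤ C₁ (1 + log(1 + |x|))`
  have hmult : ∀ x : ℝ, ({i : ι | γ i = x}.ncard : ℝ) ≤ C₁ * (1 + Real.log (1 + |x|)) := by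
    intro x
    rw [Set.ncard_eq_toFinset_card _ (hfin x)]
    refine hupp ι γ hγ x (hfin x).toFinset fun i hi => ?_
    have hix : γ i = x := (hfin x).mem_toFinset.1 hi
    rw [hix, sub_self, abs_zero]
    exact zero_le_one
  set H : ℝ := 2 + R₀ + Real.exp (2 * C / c) with hH
  have hexp : 0 < Real.exp (2 * C / c) := Real.exp_pos _
  have hH0 : 0 < H := by positivity
  have hstack := saturatedAtoms_stack γ (fun x : ℝ => weilMellin u (1 / 2 + (x : ℂ) * I) = 0)
    hR₀ hL (fun T hT => saturatedAtoms_cell γ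
      (fun x : ℝ => weilMellin u (1 / 2 + (x : ℂ) * I) = 0) hvan hfin hc hC₁ hκ0 hR₀ le_rfl
      (hlow ι γ hγ) hmult hT)
  -- the saturated set and its finiteness
  set Gs : ℝ → Set ℝ := fun r =>
    {x : ℝ | 1 < |x| ∧ |x| ≤ r ∧ κ * Real.log |x| ≤ ({i : ι | γ i = x}.ncard : ℝ)} with hGs
  have hGfin : ∀ r : ℝ, (Gs r).Finite := by
    intro r
    refine ((finite_abs_le_of_windowTrace h2a hγ r).image γ).subset ?_
    rintro x ⟨hx1, hxr, hxm⟩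
    have hposκ : 0 < κ * Real.log |x| := mul_pos hκ0 (Real.log_pos hx1)
    have hne : {i : ι | γ i = x}.ncard ≠ 0 := by
      intro h0
      rw [h0, Nat.cast_zero] at hxm
      linarith
    obtain ⟨i, hi⟩ := Set.nonempty_of_ncard_ne_zero hne
    simp only [Set.mem_setOf_eq] at hi
    exact ⟨i, by simp only [Set.mem_setOf_eq]; rw [hi]; exact hxr, hi⟩
  have hGmono : ∀ r r' : ℝ, r ≤ r' → ((Gs r).ncard : ℝ) ≤ (Gs r').ncard := by
    intro r r' hrr'
    have hsub : Gs r ⊆ Gs r' := fun x ⟨h1, h2, h3⟩ => ⟨h1, h2.trans hrr', h3⟩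
    exact_mod_cast Set.ncard_le_ncard hsub (hGfin r')
  -- Jensen on the stacked cells
  have hbound : ∀ n : ℕ, (n : ℝ) * (c / 2) ≤
      3 * C₁ * (Gs (H + L * n + R₀)).ncard + 2 * κ * (α * (H + L * n + R₀) + β') := by
    intro n
    obtain ⟨A, G, hA, hG, hcnt⟩ := hstack n
    have hn0 : (0 : ℝ) ≤ n := Nat.cast_nonneg n
    have hr0 : 0 ≤ H + L * n + R₀ := by positivity
    have hJn : (A.card : ℝ) ≤ 2 * a / Real.log 2 * (H + L * n + R₀) + β := hJ _ hr0 A fun x hx => by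
      obtain ⟨h0, h1, h2⟩ := hA x hx
      exact ⟨by rw [abs_of_nonneg (by linarith)]; exact h2, h0⟩
    have hGn : (G.card : ℝ) ≤ (Gs (H + L * n + R₀)).ncard := by
      have hsub : (↑G : Set ℝ) ⊆ Gs (H + L * n + R₀) := fun x hx => by
        obtain ⟨h1, h2, h3⟩ := hG x (Finset.mem_coe.1 hx)
        have hx1 : 1 < x := by linarith
        have hxabs : |x| = x := abs_of_pos (by linarith)
        refine ⟨by rw [hxabs]; exact hx1, by rw [hxabs]; exact h2, h3⟩
      have := Set.ncard_le_ncard hsub (hGfin _)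
      rw [Set.ncard_coe_finset] at this
      exact_mod_cast this
    have e1 := mul_le_mul_of_nonneg_left hGn (by positivity : (0 : ℝ) ≤ 3 * C₁)
    have e2 := mul_le_mul_of_nonneg_left hJn (by positivity : (0 : ℝ) ≤ 2 * κ)
    have e3 := mul_le_mul_of_nonneg_left hββ' (by positivity : (0 : ℝ) ≤ 2 * κ)
    rw [← hα] at e2
    linarith only [hcnt, e1, e2, e3]
  -- conclusion for every large `r`
  set E₁ : ℝ := c / 2 * (H + R₀ + L) + 2 * L * κ * β' with hE₁
  have hE₁0 : 0 ≤ E₁ := by positivity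
  refine ⟨max (H + R₀ + L) (4 * E₁ / c), fun r hr => ⟨hGfin r, ?_⟩⟩
  have hr1 : H + R₀ + L ≤ r := (le_max_left _ _).trans hr
  have hr0 : 0 ≤ r := by linarith
  have hrE : 4 * E₁ ≤ r * c := (div_le_iff₀ hc).1 ((le_max_right _ _).trans hr)
  -- the number `n` of cells below `r`
  set y : ℝ := (r - H - R₀) / L with hy
  have hy0 : 0 ≤ y := div_nonneg (by linarith) hL0.le
  have hyL : y * L = r - H - R₀ := by
    rw [hy]
    field_simp
  obtain ⟨n, hn1, hn2⟩ : ∃ n : ℕ, (n : ℝ) ≤ y ∧ y < n + 1 :=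
    ⟨⌊y⌋₊, Nat.floor_le hy0, Nat.lt_floor_add_one y⟩
  have hrn : H + L * n + R₀ ≤ r := by
    have := mul_le_mul_of_nonneg_left hn1 hL0.le
    linarith only [this, hyL]
  have hLn : r - H - R₀ - L ≤ L * n := by
    have := mul_le_mul_of_nonneg_left hn2.le hL0.le
    linarith only [this, hyL]
  have hb := hbound n
  have hmono := hGmono _ r hrn
  -- linear assembly (every product pre-multiplied)
  have h3C : (0 : ℝ) ≤ L * (3 * C₁) := by positivity
  have h2κ : (0 : ℝ) ≤ 2 * κ * α * L := by positivity
  have P1 := mul_le_mul_of_nonneg_left hb hL0.le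
  have P2 := mul_le_mul_of_nonneg_left hmono h3C
  have P3 := mul_le_mul_of_nonneg_left hrn h2κ
  have P4 := mul_le_mul_of_nonneg_left hLn (half_pos hc).le
  have P5 := mul_le_mul_of_nonneg_right hκα' hr0
  have P6 := mul_le_mul_of_nonneg_right hκC' hr0
  have hfinal : L * (3 * C₁ * (κ * r)) ≤ L * (3 * C₁ * ((Gs r).ncard : ℝ)) := by
    linarith only [P1, P2, P3, P4, P5, P6, hrE, hE₁]
  exact le_of_mul_le_mul_left (le_of_mul_le_mul_left hfinal hL0) (by positivity)

/-- **Dichotomy form.** For `a > 0`, with `κ = κ(a) > 0` of `saturatedAtoms_linear_density`: for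
every ground state `u` of `[-a, a]` and every real family `γ` reproducing the Weil functional on the
Weil tests of `[-2a, 2a]`, EITHER some `û(1/2 + iγ_i) ≠ 0` (the conclusion of the registered edge stub
`stub_coagulationDense`) OR the saturated atoms `{x : 1 < |x| ≤ r, κ log|x| ≤ #{i | γ i = x}}` number
at least `κ r` for all large `r`. [folklore] -/
theorem coagulation_excluded_or_saturated :
    ∀ a : ℝ, 0 < a → ∃ κ : ℝ, 0 < κ ∧
      ∀ u : ℝ → ℂ, Literature.NumberTheory.LFunctions.IsWeilGroundState a u →
        ∀ (ι : Type) (γ : ι → ℝ),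
          (∀ g : ℝ → ℂ, Literature.NumberTheory.LFunctions.IsWeilTest g →
            tsupport g ⊆ Set.Icc (-(2 * a)) (2 * a) →
              HasSum (fun i => Literature.NumberTheory.LFunctions.weilMellin g (1 / 2 + (γ i : ℂ) * Complex.I))
                (Literature.NumberTheory.LFunctions.weilFunctional g)) →
          (∃ i : ι, Literature.NumberTheory.LFunctions.weilMellin u (1 / 2 + (γ i : ℂ) * Complex.I) ≠ 0) ∨
          ∃ r₀ : ℝ, ∀ r : ℝ, r₀ ≤ r →
            κ * r ≤ ({x : ℝ | 1 < |x| ∧ |x| ≤ r ∧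
              κ * Real.log |x| ≤ ({i : ι | γ i = x}.ncard : ℝ)}.ncard : ℝ) := by
  intro a ha
  obtain ⟨κ, hκ, h⟩ := saturatedAtoms_linear_density a ha
  refine ⟨κ, hκ, fun u hu ι γ hγ => ?_⟩
  by_cases hvan : ∀ i : ι, weilMellin u (1 / 2 + (γ i : ℂ) * I) = 0
  · obtain ⟨r₀, hr₀⟩ := h u hu ι γ hγ hvan
    exact Or.inr ⟨r₀, fun r hr => (hr₀ r hr).2⟩
  · push Not at hvan
    exact Or.inl hvan

end Summit.RiemannHypothesis.RiemannHypothesis.Theorems.SpectralTraceWindowStep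

end
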